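import Summits.QuantumFields.QCD.Theses.CentreStabilisedCircle
import Literature.MathematicalPhysics.QuantumFieldTheory.QCDCurrentSector

/-!
# Birth skeleton (BC3) for crux `SmallCircleGap` (stmt-QuantumFields-10527) — `Lines/birth.lean`

Registrar: `planner-skel-stmt-QuantumFields-10527-0` (skeleton-register one-shot; route
`route-QuantumFields-CentreStabilisedCircle`, sub-problem QCD, re-audit bin REPAIRABLE), 2026-08-17.
Crux decl `Summit.QuantumFields.QCD.Theses.CentreStabilisedCircle.SmallCircleGap` (rank 3, "the Ünsal–Yaffe
small-circle regime as a lattice theorem"): for `N_f ∈ {2, 3}` SOME mass-scaling, asymptotically scaling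
regularisation `reg` and threshold `M₀` such that for every nominal mass tuple `m > M₀` the bare masses stay
on the physical branch and the centre-stabilised, flavour-twisted circle theory clusters in a window
`a_k N_t ∈ [ℓ₀, 2ℓ₀]` under some profile `(h, θ)` (`WindowClustering reg m` below, verbatim the crux tail).

## The cut (line-neutral; the route's own two-layer plan made typeable, plus the piece it was missing)

Route header, TWO-LAYER PLAN: `SmallCircleGap ⇐ Abelianisation → RootLatticeDebyeScreening` ("Abelianisation
waits for a norm in which remainder < fugacity can be typed"; RootLatticeDebyeScreening filed informally as
stmt-QuantumFields-9755).  This skeleton types BOTH — the screening node over a locally DEFINED model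
(`A2Gas.*`, the two-component lattice sine-Gordon / affine-`A₂` Coulomb gas on the three-torus), the
abelianisation node as the TRANSFER `A2DebyeScreening → SmallCircleLawStmt` — and adds the ∃-piece that the
crux's `∃ reg` hides and that no cheap witness supplies:

**Scale honesty is load-bearing.**  The small-circle mechanism needs the coupling small at the circle scale,
`L ≤ 2ℓ₀ ≪ 1/Λ_YM(m)`, with `ℓ₀` FIXED along `k`.  Along a regularisation whose physical quark masses run
away (`M_k → ∞`: e.g. `m_crit ≡ 0` as in `canonicalAF`, whose true Wilson critical mass `≈ −c g₀(k)²` puts the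
bare mass `a_k m/Z_m` at physical mass `∼ g₀²Z_m/a_k → ∞`; or cutoff-decoupled quarks — the refuter's
degenerate witness on this item, crux_attack_10527.md) the bare coupling still follows `afBeta N_f Λ a_k`, so
matching at the quark threshold gives `Λ_YM,k = M_k^{1−r} Λ^r → ∞`, `r = b₀(N_f)/b₀(0) = 1 − 2N_f/33 < 1`
(cutoff-decoupled: `a_kΛ_YM = (a_kΛ)^r`, `Λ_YM = Λ^r a_k^{r−1} → ∞`).  The nominal window `a_k N_t ∈ [ℓ₀, 2ℓ₀]`
is then a circle of PHYSICAL size `L·Λ_YM,k → ∞` with `N_t, N_s → ∞`: the crux restricted to such a witness IS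
the zero-temperature Yang–Mills lattice mass gap (deformation or not — `h` cannot trivialise the magnetic
sector), not the Ünsal–Yaffe regime.  Hence (i) the universal small-circle law must carry a NON-RUNAWAY
hypothesis or it contains `YangMills`, and (ii) the witness must tune `m_crit(k)` onto the true critical line to
POWER accuracy `O(a_k/Z_m(k))` — beyond every finite order of lattice perturbation theory
(`Literature.Barriers.QuantumFields.LinearDivergenceRenormalon`: the additive mass is a linearly divergent
series with an `O(a Λ)` renormalon ambiguity; evasion (printed there): a NON-perturbative pin read off the
large-time decay of a propagator / the pion mass).  `NonRunaway` below is such a pin in the weakest form the law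
needs: an effective-mass UPPER bound in a flavoured pseudoscalar channel, typed as a RATIO of the same bare
torus correlator at two physical separations (renormalisation- and `a⁶`-free), eventually in `k`.

* `stub_honestLine : HonestLineStmt` (∃-piece; open, XL — "CriticalLine to O(a)") — for `N_f ∈ {2,3}` a
  mass-scaling, asymptotically scaling `reg` and `M₀ ≥ 0` such that every `m > M₀` is on the physical branch
  AND non-runaway.  True for the honest Wilson regularisation (`m_crit` = the critical line; flavoured meson
  mass `≈ 2m + O(Λ)` finite; the ratio bound is a Jensen/transfer-matrix LOWER bound from two local
  expectations); false for every cheap witness in the tree (`canonicalAF`, `zeroAF`, decoupling families: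
  complete-monotone decay at rates `→ ∞` in nominal units, `HoppingExpansionLocality` for the cutoff-heavy
  ones).  Why it might fail: it asks a non-perturbative construction of the mass renormalisation of Wilson
  quarks at weak coupling (the same object ChiralCompletion's foreseen child CriticalLine needs, here only to
  bounded — not vanishing — physical offset).
* `stub_rootLatticeDebyeScreening : A2DebyeScreening` (open, M/L — the separately attackable engine) — Debye
  screening of the affine-`A₂` lattice Coulomb gas at small fugacity: exponential clustering of bounded,
  dual-lattice-periodic local observables, `ζ ∈ [ζ₁, ζ₀]`, `g` in a compact range, UNIFORMLY in the volume
  `N` and in the infrared regulator `ε ∈ (0, 1]` (periodic observables factor through the compact variables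
  `e^{iα·φ}`, so the torus zero mode is harmless — the refuters' typing caveat on 9755; volumes below
  the Debye length are trivially inside the bound since `c ∼ 1/ℓ_D(ζ₁)`, `dist ≤ N/2` and `|conn| ≤ 2`).  Scalar-charge versions
  are theorems (Brydges1978, BrydgesFederbush1980; GopfertMack1982 for Villain `U(1)₃`); the vector-charge
  (`ℝ²`-valued field, three charges `α₀ + α₁ + α₂ = 0`, `|α|² = 2`) extension is the stub.  Why it might
  fail: only by a typing slip — the mathematics is the Brydges sine-Gordon cluster expansion with a
  positive-definite two-component covariance.
* `stub_abelianisation : A2DebyeScreening → SmallCircleLawStmt` (open, XL — the 4D core) — given screening,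
  the SMALL-CIRCLE LAW over the honest class: for every `N_f ∈ {2,3}` and EVERY mass-scaling, asymptotically
  scaling `reg` there is `M₁` such that every `m > M₁` on the physical branch that is non-runaway has window
  clustering.  Content: Bałaban-type multiscale integration of the non-Cartan, Kaluza–Klein and quark modes of
  the deformed, twisted slab theory at `a_k N_t ∈ [ℓ₀, 2ℓ₀]` down to the circle scale (coupling `g(1/L)` small
  BECAUSE the scales are honest), leaving the affine-`A₂` monopole gas with fugacity `e^{−8π²/(3g²(L))}(1+o(1))`
  blocked to the scale `L` (so that the gas has `O(1)` lattice parameters and `A2DebyeScreening` applies with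
  `N ≈ N_s/N_t`, rate `c` per block `= (c/L)·a_k` per site, i.e. `Δ₀ = c/(2ℓ₀)`), plus gauge-invariant
  quasi-local remainders below the fugacity.  Why it might fail: the crux's own — no rigorous abelianisation
  with the non-local double-trace weight; non-Villain Cartan remainder `O(g⁴) ≫` fugacity; and the seam is
  IDEALISED: the blocked effective gas is nearest-neighbour sine-Gordon only up to small quasi-local
  perturbations, so a proof will want screening in a robust form (the lead re-cuts `A2DebyeScreening` to the
  perturbed class it actually derives; the idealised model is the case `δ = 0`).

`SmallCircleGap_of : HonestLineStmt → A2DebyeScreening → AbelianisationStmt → SmallCircleGap` is a real proof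
(the shape of the route's `closes`: `reg`, scaling and `M₀` from the honest line, `M₁` from the law fed with
screening at that very `reg`, threshold `max M₀ M₁`, branch from the line, window clustering from the law);
`smallCircleGap_of_stubs : SmallCircleGap` instantiates it with the three stubs (the registered target).

## What is NOT a stub here, and why
* The `∃ reg` PREFIX alone (scaling + branch) is cheap (`canonicalAF`; refuter's `prefix_canonicalAF`,
  `S10527_of_tail`) — bookkeeping, folded into `stub_honestLine` together with the non-runaway pin that makes
  it genuine.
* Deformed PURE Yang–Mills on the small circle (`qcdCircleExpect (Nf := 0)` along a `QCDRegularisation 0`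
  with `afBeta 0` scaling) is the natural SPECIAL CASE / first milestone of the law (no quarks, no honesty
  issue: `m_crit` absent), recommended as the lead's BC5-type warm-up; it is not a lemma toward the crux (a
  decoupling transfer would need it for Wilson-plus-quasi-local actions, which is untypeable today).
* Centre stability at the level of Polyakov-loop expectations is a CONSEQUENCE the RG proof produces, not a
  hypothesis it can consume — not cut there.

## Negative knowledge honoured
* `Cruxes/SmallCircleGap/` was EMPTY at registration (no `Disproof.lean`, no ideas, no lines); no
  `Theorems/SmallCircleGap/Negative/*`.
* `ledger negatives --problem QuantumFields` (2026-08-17: 5 entries — RobustYangMillsRG 14958, MirrorModularBoosts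
  9665, AdaptiveCoarseSystem 9494, MultibosonLatticeGap 9599, AdmissibleRootsExist 9603): none concerns circle
  compactification, Coulomb gases or correlator-ratio pins; 9599's lesson (a typed admissibility clause that is
  unsatisfiable outright) checked against `NonRunaway`: satisfiable by the honest family (ratio at two PHYSICAL
  separations, `μ` chosen after the pion mass), not by junk (`0 < ‖·‖` excludes the `Z = 0` junk value).
* Refuter evidence on the item (crux_attack_10527.md, Scratch.lean: decoupled-quark and undeformed degenerate
  witnesses; verdict SURVIVES) is exactly what `NonRunaway` prices: those witnesses satisfy the crux prefix and
  fail the pin.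
* Barriers: `LinearDivergenceRenormalon` (evaded: non-perturbative pin, above); `AokiPhase` (a witness parked
  ON an Aoki finger is non-runaway yet light — the law still owes clustering there; its Goldstones are flavour-
  CHARGED, so the existential twist profile `θP` gaps them at `O(1/L)`: the law keeps `θP` free for this
  reason); `WilsonDeterminantSign` (the twisted `N_f = 3` Berezin weight is not positive: the abelianisation
  must be sign-blind — norm bounds, no correlation inequalities); route-level `FiniteTemperatureDeconfinement`,
  `CenterSymmetryBreakingByQuarks`, `DiluteInstantonGasDivergence`, `PerturbativeInvisibility` carried over
  unchanged (deformation on, no Polyakov criterion, monopole-instantons of size `L`, gap `∝ e^{−4π²/(3g²(L))}/L`).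

## BC3 probes (registrar folder `bc/SmallCircleGap_probe.lean` = §0–§1 of this file + probes, NO sorried
theorem in scope): for each stub statement `S ∈ {HonestLineStmt, A2DebyeScreening, AbelianisationStmt}`,
`example : S → SmallCircleGap` and `example : S → QCD` by
`first | exact? | simpa | simpa [S, ·] | aesop | (intro h; exact?) | (unfold S ·; aesop)` under
`maxHeartbeats 400000` — all 6 FAIL ("unsolved goals", aesop "failed after exhaustive search"); control
`SmallCircleGap → SmallCircleGap` closes by `exact?` (lean check rc 1 as expected, wall 143 s, 2026-08-17).

`lean check --json` of this file: rc 0, errors [], sorries = 3 = stubs (`stub_honestLine`,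
`stub_rootLatticeDebyeScreening`, `stub_abelianisation`), zero elsewhere.
-/

noncomputable section

namespace Summit.QuantumFields.QCD.Cruxes.SmallCircleGap.Birth

open scoped BigOperators Topology
open MeasureTheory Filter
open Literature.MathematicalPhysics.QuantumLattice Literature.MathematicalPhysics.QuantumFieldTheory
open Summit.QuantumFields.QCD.Theses.CentreStabilisedCircle

/-! ## §0 Currency -/

/-- **Window clustering** of the centre-stabilised circle theory at `(reg, m)`: verbatim the tail of the
crux `SmallCircleGap` — a window `ℓ₀ > 0` and a deformation/twist profile under which
`reg.HasCircleClustering m (ℓ₀ ≤ a_k N_t ≤ 2ℓ₀) hP θP`. -/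
def WindowClustering {Nf : ℕ} (reg : QCDRegularisation Nf) (m : Fin Nf → ℝ) : Prop :=
  ∃ ℓ₀ : ℝ, 0 < ℓ₀ ∧ ∃ (hP : ℕ → ℕ → ℝ) (θP : ℕ → ℕ → Fin Nf → ℝ),
    reg.HasCircleClustering m (fun k Nt => ℓ₀ ≤ reg.a k * Nt ∧ reg.a k * Nt ≤ 2 * ℓ₀) hP θP

/-- The FLAVOURED pseudoscalar two-point function `⟨P_{fg}(0) · P_{gf}(n e₀)⟩ − ⟨P_{fg}⟩⟨P_{gf}⟩` of the
torus theory of side `2S+1` at step `k` of `reg`, nominal masses `m` (`P_{fg} = ψ̄_f γ₅ ψ_g`,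
`pseudoscalarDensityObs` of `QCDCurrentSector`; for `f ≠ g` only the connected quark-line diagram survives
the Berezin integral — no hairpin, no gauge-sector clustering enters its decay). -/
def flavouredPP {Nf : ℕ} (reg : QCDRegularisation Nf) (m : Fin Nf → ℝ) (k S : ℕ) (f g : Fin Nf)
    (n : ℕ) : ℂ :=
  qcdLatticeConnectedCorr (reg.β k) (2 * S + 1) (fun fl => (reg.scheme m 0 0).mq fl k)
    (pseudoscalarDensityObs Nf (Matrix.single f g 1)) (pseudoscalarDensityObs Nf (Matrix.single g f 1)) n

/-- **NON-RUNAWAY certificate** of `reg` at the nominal masses `m` (scale honesty, typed without a notion of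
"the" critical line): in some flavoured pseudoscalar channel `f ≠ g` there are a rate `μ` and a physical
length `d > 0` such that, eventually in `k` and on every torus `2S+1 ≥ 2L_k+1`, one finds two Euclidean times
`n₁, n₂ ≤ S` a physical distance `a_k (n₂ − n₁) ≥ d` apart between which the two-point function is non-zero
and decreases by NO MORE than the factor `e^{−μ a_k (n₂ − n₁)}` — an effective mass `≤ μ` in NOMINAL physical
units somewhere at physical distances. A ratio of the same bare correlator at two separations: every
multiplicative renormalisation (`Z_P²`) and the `a_k⁶` of point operators cancel. It fails for every RUNAWAY
family (physical quark mass `M_k → ∞`, e.g. `m_crit ≡ 0` or cutoff-decoupled quarks), whose flavoured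
correlator is completely-monotone-like with ALL rates `≳ 2M_k a_k → ∞ · a_k`. -/
def NonRunaway {Nf : ℕ} (reg : QCDRegularisation Nf) (m : Fin Nf → ℝ) : Prop :=
  ∃ f g : Fin Nf, f ≠ g ∧ ∃ μ d : ℝ, 0 < d ∧ ∀ᶠ k in atTop, ∀ S : ℕ, reg.L k ≤ S →
    ∃ n₁ n₂ : ℕ, n₂ ≤ S ∧ d ≤ reg.a k * ((n₂ : ℝ) - n₁) ∧
      0 < ‖flavouredPP reg m k S f g n₁‖ ∧
        Real.exp (-(μ * (reg.a k * ((n₂ : ℝ) - n₁)))) * ‖flavouredPP reg m k S f g n₁‖ ≤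
          ‖flavouredPP reg m k S f g n₂‖

/-! ### The two-component lattice sine-Gordon / affine-`A₂` Coulomb gas on the three-torus
(the typed form of the route's informal support node RootLatticeDebyeScreening, stmt-QuantumFields-9755) -/

namespace A2Gas

/-- Sites of the three-torus `(ℤ/N)³`. -/
abbrev Site (N : ℕ) : Type := Fin 3 → ZMod N

/-- Field configurations: an `ℝ²`-valued field (the two dual photons of `SU(3) → U(1)²`). -/
abbrev Field (N : ℕ) : Type := Site N → Fin 2 → ℝ

/-- Euclidean product on `ℝ²`. -/
def dot (u v : Fin 2 → ℝ) : ℝ := ∑ j : Fin 2, u j * v j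

/-- The three magnetic charges: the simple roots `α₁, α₂` of `A₂` and the affine (Kaluza–Klein monopole) root
`α₀ = −α₁ − α₂`, normalised to `|α|² = 2`, pairwise products `−1`. -/
def root : Fin 3 → Fin 2 → ℝ :=
  ![![Real.sqrt 2, 0], ![-(Real.sqrt 2 / 2), Real.sqrt 6 / 2], ![-(Real.sqrt 2 / 2), -(Real.sqrt 6 / 2)]]

variable {N : ℕ} [NeZero N]

/-- The lattice sine-Gordon action: massless Gaussian `(2g²)⁻¹ Σ |∇φ|²` with infrared regulator
`ε (2g²)⁻¹ Σ |φ|²`, tilted by the monopole-instanton vertex operators `−2ζ Σ_x Σ_r cos(α_r · φ_x)`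
(fugacity `ζ`). -/
def action (g ε ζ : ℝ) (φ : Field N) : ℝ :=
  (1 / (2 * g ^ 2)) *
      ((∑ x : Site N, ∑ i : Fin 3, ∑ j : Fin 2, (φ (x + Pi.single i 1) j - φ x j) ^ 2) +
        ε * ∑ x : Site N, ∑ j : Fin 2, φ x j ^ 2) -
    2 * ζ * ∑ x : Site N, ∑ r : Fin 3, Real.cos (dot (root r) (φ x))

/-- Boltzmann weight `e^{−S}`. -/
def weight (g ε ζ : ℝ) (φ : Field N) : ℝ := Real.exp (-action g ε ζ φ)

/-- Gibbs expectation `⟨F⟩ = ∫ F e^{−S} dφ / ∫ e^{−S} dφ` (Lebesgue measure on the finite-dimensional field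
space). -/
def expect (g ε ζ : ℝ) (F : Field N → ℝ) : ℝ :=
  (∫ φ : Field N, F φ * weight g ε ζ φ) / ∫ φ : Field N, weight g ε ζ φ

/-- Connected correlation `⟨F G⟩ − ⟨F⟩⟨G⟩`. -/
def conn (g ε ζ : ℝ) (F G : Field N → ℝ) : ℝ :=
  expect g ε ζ (fun φ => F φ * G φ) - expect g ε ζ F * expect g ε ζ G

/-- Sup-norm distance on the three-torus. -/
def dist (x y : Site N) : ℕ := Finset.univ.sup fun i : Fin 3 => ((x i - y i).valMinAbs).natAbs

/-- Admissible local observables of the gas supported in `X`: measurable, bounded by `1`, depending on the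
field in `X` only, and invariant under sitewise shifts of the field by the lattice DUAL to the charges
(`α_r · w ∈ 2πℤ` for all `r`) — the observables of the compact (Coulomb-gas) variables `e^{iα·φ}`. -/
structure IsObservable (X : Finset (Site N)) (F : Field N → ℝ) : Prop where
  measurable : Measurable F
  bounded : ∀ φ, |F φ| ≤ 1
  isLocal : ∀ φ ψ : Field N, (∀ x ∈ X, φ x = ψ x) → F φ = F ψ
  periodic : ∀ (φ : Field N) (x : Site N) (w : Fin 2 → ℝ),
    (∀ r : Fin 3, ∃ n : ℤ, dot (root r) w = 2 * Real.pi * n) → F (Function.update φ x (φ x + w)) = F φ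

end A2Gas

/-- **Debye screening of the affine-`A₂` lattice Coulomb gas at small fugacity** (the typed
RootLatticeDebyeScreening): for couplings `g` in a compact range there is `ζ₀ > 0` such that for fugacities
`ζ ∈ [ζ₁, ζ₀]` (any `ζ₁ > 0`) connected correlations of admissible local observables supported within
distance `R₀` of `0` and of `y` decay like `C e^{−c · dist(0, y)}`, with `C, c > 0` depending on
`(g₁, g₂, ζ₁, R₀)` only — uniformly in the volume `N`, in the infrared regulator `ε ∈ (0, 1]` and in the
observables. -/
def A2DebyeScreening : Prop :=
  ∀ g₁ g₂ : ℝ, 0 < g₁ → g₁ ≤ g₂ → ∃ ζ₀ : ℝ, 0 < ζ₀ ∧ ∀ ζ₁ : ℝ, 0 < ζ₁ → ζ₁ ≤ ζ₀ → ∀ R₀ : ℕ,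
    ∃ C c : ℝ, 0 < c ∧ ∀ g ζ ε : ℝ, g₁ ≤ g → g ≤ g₂ → ζ₁ ≤ ζ → ζ ≤ ζ₀ → 0 < ε → ε ≤ 1 →
      ∀ (N : ℕ) [NeZero N] (y : A2Gas.Site N) (X Y : Finset (A2Gas.Site N))
        (F G : A2Gas.Field N → ℝ),
        (∀ x ∈ X, A2Gas.dist x 0 ≤ R₀) → (∀ x ∈ Y, A2Gas.dist x y ≤ R₀) →
          A2Gas.IsObservable X F → A2Gas.IsObservable Y G →
            |A2Gas.conn g ε ζ F G| ≤ C * Real.exp (-(c * A2Gas.dist 0 y))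

/-! ## §1 The three stub statements -/

/-- **(S1) HONEST LINE** (the ∃-piece: scale setting = critical-line tuning to `O(a_k/Z_m)`).  For
`N_f ∈ {2, 3}` there are a mass-scaling, asymptotically scaling regularisation and `M₀ ≥ 0` such that every
nominal mass tuple `m > M₀` is eventually on the physical branch AND non-runaway (`NonRunaway reg m`).  Why
plausibly true: the honest Wilson regularisation (`m_crit(k)` ON the critical line, or shifted by a bounded
physical offset) has flavoured pseudoscalar mass `M_π(m) < ∞` in nominal units, and the ratio bound at two
physical separations follows from reflection positivity / Jensen with `μ > M_π(m)`.  Why it might fail: it is a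
non-perturbative construction of the additive mass renormalisation at weak coupling (power accuracy; the
`LinearDivergenceRenormalon` barrier forbids any perturbative shortcut).  Size: XL / open. -/
def HonestLineStmt : Prop :=
  ∀ Nf : ℕ, Nf = 2 ∨ Nf = 3 → ∃ reg : QCDRegularisation Nf,
    reg.HasMassScaling ∧ (reg.scheme 0 0 0).HasAsymptoticScaling ∧
      ∃ M₀ : ℝ, 0 ≤ M₀ ∧ ∀ m : Fin Nf → ℝ, (∀ f, M₀ < m f) →
        (∀ f, ∀ᶠ k in atTop, -1 < (reg.scheme m 0 0).mq f k) ∧ NonRunaway reg m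

/-- **(S3's consequent) SMALL-CIRCLE LAW over the honest class** (∀-law: the Ünsal–Yaffe regime as a lattice
theorem).  For `N_f ∈ {2, 3}` and EVERY mass-scaling, asymptotically scaling regularisation there is `M₁ ≥ 0`
such that every `m > M₁` eventually on the physical branch and NON-RUNAWAY has the crux's window clustering.
Without `NonRunaway` this statement would contain the Yang–Mills lattice gap (runaway witnesses, module
docstring); with it, `g(1/L)` is small on the window for `ℓ₀ = ℓ₀(μ, m)` and the semiclassical regime applies. -/
def SmallCircleLawStmt : Prop :=
  ∀ Nf : ℕ, Nf = 2 ∨ Nf = 3 → ∀ reg : QCDRegularisation Nf,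
    reg.HasMassScaling → (reg.scheme 0 0 0).HasAsymptoticScaling →
      ∃ M₁ : ℝ, 0 ≤ M₁ ∧ ∀ m : Fin Nf → ℝ, (∀ f, M₁ < m f) →
        (∀ f, ∀ᶠ k in atTop, -1 < (reg.scheme m 0 0).mq f k) → NonRunaway reg m →
          WindowClustering reg m

/-- **(S3) ABELIANISATION** — the transfer: Debye screening of the affine-`A₂` gas ⇒ the small-circle law
over the honest class (multiscale integration of non-Cartan / Kaluza–Klein / quark modes of the deformed
twisted slab theory down to the circle scale, monopole gas blocked to scale `L`, remainders below the
fugacity).  Why it might fail: the crux's own (no rigorous abelianisation with the double-trace weight;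
Cartan remainder vs fugacity), and the idealised seam (a proof consumes screening for the PERTURBED gas it
derives — re-cut by the lead if needed).  Size: XL / open. -/
def AbelianisationStmt : Prop := A2DebyeScreening → SmallCircleLawStmt

/-! ## §2 The registered stubs (the ONLY `sorry`s of this file) -/

/-- (S1) the honest line — open (critical-line tuning to power accuracy; size XL). -/
theorem stub_honestLine : HonestLineStmt := by
  sorry

/-- (S2) Debye screening of the affine-`A₂` lattice Coulomb gas — open, size M/L (Brydges 1978 /
Brydges–Federbush 1980 / Göpfert–Mack 1982 for scalar charges; the vector-charge extension). -/
theorem stub_rootLatticeDebyeScreening : A2DebyeScreening := by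
  sorry

/-- (S3) abelianisation: screening ⇒ the small-circle law over the honest class — open, size XL. -/
theorem stub_abelianisation : AbelianisationStmt := by
  sorry

/-! ## §3 Composition (kernel-checked; no `sorry` below this line) -/

/-- **The crux from the three stubs** (concludes `SmallCircleGap` BY NAME): the honest line gives the
regularisation, its scaling clauses, the physical branch and the non-runaway certificate above `M₀`;
abelianisation fed with Debye screening gives the small-circle law, i.e. a threshold `M₁` for that very
regularisation; above `max M₀ M₁` the law's conclusion is the crux's window clustering. -/
theorem SmallCircleGap_of : HonestLineStmt → A2DebyeScreening → AbelianisationStmt → SmallCircleGap := by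
  intro hH hD hA Nf hNf
  obtain ⟨reg, hms, has, M₀, hM₀, hm⟩ := hH Nf hNf
  obtain ⟨M₁, hM₁, hlaw⟩ := hA hD Nf hNf reg hms has
  refine ⟨reg, hms, has, max M₀ M₁, le_max_of_le_left hM₀, fun m hmM => ?_⟩
  have h0 : ∀ f, M₀ < m f := fun f => lt_of_le_of_lt (le_max_left _ _) (hmM f)
  have h1 : ∀ f, M₁ < m f := fun f => lt_of_le_of_lt (le_max_right _ _) (hmM f)
  obtain ⟨hbr, hnr⟩ := hm m h0
  exact ⟨hbr, hlaw m h1 hbr hnr⟩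

/-- The crux along this skeleton, from the registered stubs (sorries only inside `stub_*`). -/
theorem smallCircleGap_of_stubs : SmallCircleGap :=
  SmallCircleGap_of stub_honestLine stub_rootLatticeDebyeScreening stub_abelianisation

end Summit.QuantumFields.QCD.Cruxes.SmallCircleGap.Birth

end
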